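import Mathlib
import HarnessLib
import Summits.AtomisticToContinuum.Crystallization.Theorems.PricedLinkCensusSoftFourRingsTwoBlocksA

/-!
# Soft four-rings: two slack triangles are impossible (second part)

Support file for `SoftFourRings` (route `PricedLinkCensus`, sub-problem `Crystallization`).
Bond-set level: the data of a block (the conclusion of `slack_block`, without the bond-triangle
counts) is taken as one hypothesis per block.

* `two_blocks_cc1`, `two_blocks_cc2` : the two closure cases for `r₁ = c₂`, `r₂ = c₁`.
-/

namespace Summit.AtomisticToContinuum.Crystallization.Theorems

open Real RealInnerProductSpace Literature.Geometry.DiscreteGeometry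

section Setting

variable {X : Finset (EuclideanSpace ℝ (Fin 3))} {B : Finset (Finset (EuclideanSpace ℝ (Fin 3)))}
  (hB : ∀ T ∈ B, ∃ u ∈ X, ∃ u' ∈ X, u ≠ u' ∧ 1 - (101 / 100 : ℝ) ^ 2 / 2 ≤ ⟪u, u'⟫ ∧ T = {u, u'})
  (hcard : X.card = 12)
  (hdeg : ∀ v ∈ X, ∃ w : Fin 4 → EuclideanSpace ℝ (Fin 3), (∀ k, w k ∈ X) ∧
    Function.Injective w ∧ (∀ k, w k ≠ v) ∧
    (∀ k, ({v, w k} : Finset (EuclideanSpace ℝ (Fin 3))) ∈ B) ∧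
    ∀ y, ({v, y} : Finset (EuclideanSpace ℝ (Fin 3))) ∈ B → ∃ k, y = w k)

include hB hcard hdeg in
/-- Closure case for `r₁ = c₂`, `r₂ = c₁` (parallel identification of the two `c`-fans). -/
theorem two_blocks_cc1 {a1 b1 c1 p1 q1 u1 w1 m1 n1 r1 a2 b2 c2 p2 q2 u2 w2 m2 n2 r2 : EuclideanSpace ℝ (Fin 3)}
    (ha1 : a1 ∈ X) (hb1 : b1 ∈ X) (hc1 : c1 ∈ X) (ha2 : a2 ∈ X) (hb2 : b2 ∈ X) (hc2 : c2 ∈ X)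
    (h1 : ((p1 ∈ X ∧ q1 ∈ X ∧ u1 ∈ X ∧ w1 ∈ X ∧ m1 ∈ X ∧ n1 ∈ X ∧ r1 ∈ X) ∧
      (∀ y, ({a1, y} : Finset (EuclideanSpace ℝ (Fin 3))) ∈ B ↔ (y = p1 ∨ y = u1 ∨ y = r1 ∨ y = b1)) ∧
      (∀ y, ({b1, y} : Finset (EuclideanSpace ℝ (Fin 3))) ∈ B ↔ (y = q1 ∨ y = w1 ∨ y = r1 ∨ y = a1)) ∧
      (∀ y, ({c1, y} : Finset (EuclideanSpace ℝ (Fin 3))) ∈ B ↔ (y = p1 ∨ y = n1 ∨ y = m1 ∨ y = q1)) ∧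
      (∀ y, ({r1, y} : Finset (EuclideanSpace ℝ (Fin 3))) ∈ B ↔ (y = u1 ∨ y = a1 ∨ y = b1 ∨ y = w1)) ∧
      (({p1, u1} : Finset (EuclideanSpace ℝ (Fin 3))) ∈ B ∧
        ({u1, r1} : Finset (EuclideanSpace ℝ (Fin 3))) ∈ B ∧
        ({r1, b1} : Finset (EuclideanSpace ℝ (Fin 3))) ∈ B ∧
        ({q1, w1} : Finset (EuclideanSpace ℝ (Fin 3))) ∈ B ∧
        ({w1, r1} : Finset (EuclideanSpace ℝ (Fin 3))) ∈ B ∧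
        ({p1, n1} : Finset (EuclideanSpace ℝ (Fin 3))) ∈ B ∧
        ({n1, m1} : Finset (EuclideanSpace ℝ (Fin 3))) ∈ B ∧
        ({m1, q1} : Finset (EuclideanSpace ℝ (Fin 3))) ∈ B) ∧
      (({p1, r1} : Finset (EuclideanSpace ℝ (Fin 3))) ∉ B ∧
        ({u1, b1} : Finset (EuclideanSpace ℝ (Fin 3))) ∉ B ∧
        ({p1, b1} : Finset (EuclideanSpace ℝ (Fin 3))) ∉ B ∧
        ({q1, r1} : Finset (EuclideanSpace ℝ (Fin 3))) ∉ B ∧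
        ({w1, a1} : Finset (EuclideanSpace ℝ (Fin 3))) ∉ B ∧
        ({q1, a1} : Finset (EuclideanSpace ℝ (Fin 3))) ∉ B ∧
        ({p1, m1} : Finset (EuclideanSpace ℝ (Fin 3))) ∉ B ∧
        ({n1, q1} : Finset (EuclideanSpace ℝ (Fin 3))) ∉ B ∧
        ({p1, q1} : Finset (EuclideanSpace ℝ (Fin 3))) ∉ B ∧
        ({u1, w1} : Finset (EuclideanSpace ℝ (Fin 3))) ∉ B) ∧
      ((p1 ≠ u1 ∧ p1 ≠ r1 ∧ p1 ≠ b1 ∧ u1 ≠ r1 ∧ u1 ≠ b1 ∧ r1 ≠ b1) ∧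
        (q1 ≠ w1 ∧ q1 ≠ r1 ∧ q1 ≠ a1 ∧ w1 ≠ r1 ∧ w1 ≠ a1 ∧ r1 ≠ a1) ∧
        (p1 ≠ n1 ∧ p1 ≠ m1 ∧ p1 ≠ q1 ∧ n1 ≠ m1 ∧ n1 ≠ q1 ∧ m1 ≠ q1) ∧
        (u1 ≠ a1 ∧ u1 ≠ b1 ∧ u1 ≠ w1 ∧ a1 ≠ b1 ∧ a1 ≠ w1 ∧ b1 ≠ w1) ∧ r1 ≠ c1) ∧
      (∀ y, ({p1, y} : Finset (EuclideanSpace ℝ (Fin 3))) ∈ B ↔ (y = a1 ∨ y = u1 ∨ y = c1 ∨ y = n1)) ∧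
      (∀ y, ({q1, y} : Finset (EuclideanSpace ℝ (Fin 3))) ∈ B ↔ (y = b1 ∨ y = w1 ∨ y = c1 ∨ y = m1))))
    (h2 : ((p2 ∈ X ∧ q2 ∈ X ∧ u2 ∈ X ∧ w2 ∈ X ∧ m2 ∈ X ∧ n2 ∈ X ∧ r2 ∈ X) ∧
      (∀ y, ({a2, y} : Finset (EuclideanSpace ℝ (Fin 3))) ∈ B ↔ (y = p2 ∨ y = u2 ∨ y = r2 ∨ y = b2)) ∧
      (∀ y, ({b2, y} : Finset (EuclideanSpace ℝ (Fin 3))) ∈ B ↔ (y = q2 ∨ y = w2 ∨ y = r2 ∨ y = a2)) ∧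
      (∀ y, ({c2, y} : Finset (EuclideanSpace ℝ (Fin 3))) ∈ B ↔ (y = p2 ∨ y = n2 ∨ y = m2 ∨ y = q2)) ∧
      (∀ y, ({r2, y} : Finset (EuclideanSpace ℝ (Fin 3))) ∈ B ↔ (y = u2 ∨ y = a2 ∨ y = b2 ∨ y = w2)) ∧
      (({p2, u2} : Finset (EuclideanSpace ℝ (Fin 3))) ∈ B ∧
        ({u2, r2} : Finset (EuclideanSpace ℝ (Fin 3))) ∈ B ∧
        ({r2, b2} : Finset (EuclideanSpace ℝ (Fin 3))) ∈ B ∧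
        ({q2, w2} : Finset (EuclideanSpace ℝ (Fin 3))) ∈ B ∧
        ({w2, r2} : Finset (EuclideanSpace ℝ (Fin 3))) ∈ B ∧
        ({p2, n2} : Finset (EuclideanSpace ℝ (Fin 3))) ∈ B ∧
        ({n2, m2} : Finset (EuclideanSpace ℝ (Fin 3))) ∈ B ∧
        ({m2, q2} : Finset (EuclideanSpace ℝ (Fin 3))) ∈ B) ∧
      (({p2, r2} : Finset (EuclideanSpace ℝ (Fin 3))) ∉ B ∧
        ({u2, b2} : Finset (EuclideanSpace ℝ (Fin 3))) ∉ B ∧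
        ({p2, b2} : Finset (EuclideanSpace ℝ (Fin 3))) ∉ B ∧
        ({q2, r2} : Finset (EuclideanSpace ℝ (Fin 3))) ∉ B ∧
        ({w2, a2} : Finset (EuclideanSpace ℝ (Fin 3))) ∉ B ∧
        ({q2, a2} : Finset (EuclideanSpace ℝ (Fin 3))) ∉ B ∧
        ({p2, m2} : Finset (EuclideanSpace ℝ (Fin 3))) ∉ B ∧
        ({n2, q2} : Finset (EuclideanSpace ℝ (Fin 3))) ∉ B ∧
        ({p2, q2} : Finset (EuclideanSpace ℝ (Fin 3))) ∉ B ∧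
        ({u2, w2} : Finset (EuclideanSpace ℝ (Fin 3))) ∉ B) ∧
      ((p2 ≠ u2 ∧ p2 ≠ r2 ∧ p2 ≠ b2 ∧ u2 ≠ r2 ∧ u2 ≠ b2 ∧ r2 ≠ b2) ∧
        (q2 ≠ w2 ∧ q2 ≠ r2 ∧ q2 ≠ a2 ∧ w2 ≠ r2 ∧ w2 ≠ a2 ∧ r2 ≠ a2) ∧
        (p2 ≠ n2 ∧ p2 ≠ m2 ∧ p2 ≠ q2 ∧ n2 ≠ m2 ∧ n2 ≠ q2 ∧ m2 ≠ q2) ∧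
        (u2 ≠ a2 ∧ u2 ≠ b2 ∧ u2 ≠ w2 ∧ a2 ≠ b2 ∧ a2 ≠ w2 ∧ b2 ≠ w2) ∧ r2 ≠ c2) ∧
      (∀ y, ({p2, y} : Finset (EuclideanSpace ℝ (Fin 3))) ∈ B ↔ (y = a2 ∨ y = u2 ∨ y = c2 ∨ y = n2)) ∧
      (∀ y, ({q2, y} : Finset (EuclideanSpace ℝ (Fin 3))) ∈ B ↔ (y = b2 ∨ y = w2 ∨ y = c2 ∨ y = m2))))
    {V3 : EuclideanSpace ℝ (Fin 3) → Prop} (hVa1 : V3 a1) (hVa2 : V3 a2) (hVb2 : V3 b2)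
    (hVc2 : V3 c2) (hVp1 : ¬ V3 p1) (hVq1 : ¬ V3 q1)
    (hdisj : ∀ y, (y = a1 ∨ y = b1 ∨ y = c1) → ¬ (y = a2 ∨ y = b2 ∨ y = c2))
    (hac1 : a1 ≠ c1) (hbc1 : b1 ≠ c1) (hac2 : a2 ≠ c2) (hbc2 : b2 ≠ c2)
    (hr1 : r1 = c2) (hr2 : r2 = c1) (hu1 : u1 = p2) (hn2 : a1 = n2) (hm2 : b1 = m2) (hw1 : w1 = q2)
    (hu2 : u2 = p1) (hn1 : a2 = n1) (hm1 : b2 = m1) (hw2 : w2 = q1) : False := by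
  classical
  obtain ⟨⟨hp1X, hq1X, hu1X, hw1X, hm1X, hn1X, hr1X⟩, hNa1, hNb1, hNc1, hNr1,
    ⟨hBpu1, hBur1, hBrb1, hBqw1, hBwr1, hBpn1, hBnm1, hBmq1⟩,
    ⟨hBpr1, hBub1, hBpb1, hBqr1, hBwa1, hBqa1, hBpm1, hBnq1, hBpq1, hBuw1⟩,
    ⟨⟨hpu1, hpr1, hpb1, hur1, hub1, hrb1⟩, ⟨hqw1, hqr1, hqa1, hwr1, hwa1, hra1⟩,
      ⟨hpn1, hpm1, hpq1, hnm1, hnq1, hmq1⟩, ⟨hua1, hub'1, huw1, hab1, haw1, hbw1⟩, hrc1⟩,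
    hNp1, hNq1⟩ := h1
  obtain ⟨⟨hp2X, hq2X, hu2X, hw2X, hm2X, hn2X, hr2X⟩, hNa2, hNb2, hNc2, hNr2,
    ⟨hBpu2, hBur2, hBrb2, hBqw2, hBwr2, hBpn2, hBnm2, hBmq2⟩,
    ⟨hBpr2, hBub2, hBpb2, hBqr2, hBwa2, hBqa2, hBpm2, hBnq2, hBpq2, hBuw2⟩,
    ⟨⟨hpu2, hpr2, hpb2, hur2, hub2, hrb2⟩, ⟨hqw2, hqr2, hqa2, hwr2, hwa2, hra2⟩,
      ⟨hpn2, hpm2, hpq2, hnm2, hnq2, hmq2⟩, ⟨hua2, hub'2, huw2, hab2, haw2, hbw2⟩, hrc2⟩,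
    hNp2, hNq2⟩ := h2
  subst r1; subst r2; subst u1; subst w1; subst n2; subst m2; subst u2; subst w2; subst n1; subst m1
  set W : Finset (EuclideanSpace ℝ (Fin 3)) := {a1, b1, c1, p1, q1, a2, b2, c2, p2, q2} with hW
  have hWX : W ⊆ X := by
    intro x hx
    simp only [W, Finset.mem_insert, Finset.mem_singleton] at hx
    rcases hx with rfl | rfl | rfl | rfl | rfl | rfl | rfl | rfl | rfl | rfl <;> assumption
  have h10 : W.card ≤ 10 := by
    have := List.toFinset_card_le [a1, b1, c1, p1, q1, a2, b2, c2, p2, q2]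
    simpa [W] using this
  have hp1a1 : p1 ≠ a1 := (ne_of_mem_bonds hB ((hNa1 p1).2 (Or.inl rfl))).symm
  have hp1c1 : p1 ≠ c1 := (ne_of_mem_bonds hB ((hNc1 p1).2 (Or.inl rfl))).symm
  have hq1b1 : q1 ≠ b1 := (ne_of_mem_bonds hB ((hNb1 q1).2 (Or.inl rfl))).symm
  have hq1c1 : q1 ≠ c1 := (ne_of_mem_bonds hB ((hNc1 q1).2 (Or.inr (Or.inr (Or.inr rfl))))).symm
  have hq1a1 : q1 ≠ a1 := fun h => hVq1 (h ▸ hVa1)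
  have hp1a2 : p1 ≠ a2 := fun h => hVp1 (h ▸ hVa2)
  have hp1b2 : p1 ≠ b2 := fun h => hVp1 (h ▸ hVb2)
  have hp1c2 : p1 ≠ c2 := fun h => hVp1 (h ▸ hVc2)
  have hq1a2 : q1 ≠ a2 := fun h => hVq1 (h ▸ hVa2)
  have hq1b2 : q1 ≠ b2 := fun h => hVq1 (h ▸ hVb2)
  have hq1c2 : q1 ≠ c2 := fun h => hVq1 (h ▸ hVc2)
  have h1a := hdisj a1 (Or.inl rfl)
  have h1b := hdisj b1 (Or.inr (Or.inl rfl))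
  have h1c := hdisj c1 (Or.inr (Or.inr rfl))
  have h8 : 8 ≤ W.card := by
    have hS : ({p1, q1, a1, b1, c1, a2, b2, c2} : Finset (EuclideanSpace ℝ (Fin 3))) ⊆ W := by
      intro x hx
      simp only [Finset.mem_insert, Finset.mem_singleton] at hx
      simp only [W, Finset.mem_insert, Finset.mem_singleton]
      rcases hx with rfl | rfl | rfl | rfl | rfl | rfl | rfl | rfl <;> simp
    have hS8 : ({p1, q1, a1, b1, c1, a2, b2, c2} : Finset (EuclideanSpace ℝ (Fin 3))).card = 8 := by
      rw [Finset.card_insert_of_notMem, Finset.card_insert_of_notMem, Finset.card_insert_of_notMem,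
        Finset.card_insert_of_notMem, Finset.card_insert_of_notMem, Finset.card_insert_of_notMem,
        Finset.card_pair hbc2]
      · simp only [Finset.mem_insert, Finset.mem_singleton, not_or]; exact ⟨hab2, hac2⟩
      · simp only [Finset.mem_insert, Finset.mem_singleton, not_or]
        exact ⟨fun h => h1c (Or.inl h), fun h => h1c (Or.inr (Or.inl h)), fun h => h1c (Or.inr (Or.inr h))⟩
      · simp only [Finset.mem_insert, Finset.mem_singleton, not_or]
        exact ⟨hbc1, fun h => h1b (Or.inl h), fun h => h1b (Or.inr (Or.inl h)),
          fun h => h1b (Or.inr (Or.inr h))⟩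
      · simp only [Finset.mem_insert, Finset.mem_singleton, not_or]
        exact ⟨hab1, hac1, fun h => h1a (Or.inl h), fun h => h1a (Or.inr (Or.inl h)),
          fun h => h1a (Or.inr (Or.inr h))⟩
      · simp only [Finset.mem_insert, Finset.mem_singleton, not_or]
        exact ⟨hq1a1, hq1b1, hq1c1, hq1a2, hq1b2, hq1c2⟩
      · simp only [Finset.mem_insert, Finset.mem_singleton, not_or]
        exact ⟨hpq1, hp1a1, hpb1, hp1c1, hp1a2, hp1b2, hp1c2⟩
    exact hS8 ▸ Finset.card_le_card hS
  refine false_of_closed hcard hdeg W hWX h8 h10 ?_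
  intro x hx z hz
  simp only [W, Finset.mem_insert, Finset.mem_singleton] at hx
  rcases hx with rfl | rfl | rfl | rfl | rfl | rfl | rfl | rfl | rfl | rfl
  · rcases (hNa1 z).1 hz with rfl | rfl | rfl | rfl <;> simp [W]
  · rcases (hNb1 z).1 hz with rfl | rfl | rfl | rfl <;> simp [W]
  · rcases (hNc1 z).1 hz with rfl | rfl | rfl | rfl <;> simp [W]
  · rcases (hNp1 z).1 hz with rfl | rfl | rfl | rfl <;> simp [W]
  · rcases (hNq1 z).1 hz with rfl | rfl | rfl | rfl <;> simp [W]
  · rcases (hNa2 z).1 hz with rfl | rfl | rfl | rfl <;> simp [W]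
  · rcases (hNb2 z).1 hz with rfl | rfl | rfl | rfl <;> simp [W]
  · rcases (hNc2 z).1 hz with rfl | rfl | rfl | rfl <;> simp [W]
  · rcases (hNp2 z).1 hz with rfl | rfl | rfl | rfl <;> simp [W]
  · rcases (hNq2 z).1 hz with rfl | rfl | rfl | rfl <;> simp [W]

include hB hcard hdeg in
/-- Closure case for `r₁ = c₂`, `r₂ = c₁` (crossed identification of the two `c`-fans). -/
theorem two_blocks_cc2 {a1 b1 c1 p1 q1 u1 w1 m1 n1 r1 a2 b2 c2 p2 q2 u2 w2 m2 n2 r2 : EuclideanSpace ℝ (Fin 3)}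
    (ha1 : a1 ∈ X) (hb1 : b1 ∈ X) (hc1 : c1 ∈ X) (ha2 : a2 ∈ X) (hb2 : b2 ∈ X) (hc2 : c2 ∈ X)
    (h1 : ((p1 ∈ X ∧ q1 ∈ X ∧ u1 ∈ X ∧ w1 ∈ X ∧ m1 ∈ X ∧ n1 ∈ X ∧ r1 ∈ X) ∧
      (∀ y, ({a1, y} : Finset (EuclideanSpace ℝ (Fin 3))) ∈ B ↔ (y = p1 ∨ y = u1 ∨ y = r1 ∨ y = b1)) ∧
      (∀ y, ({b1, y} : Finset (EuclideanSpace ℝ (Fin 3))) ∈ B ↔ (y = q1 ∨ y = w1 ∨ y = r1 ∨ y = a1)) ∧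
      (∀ y, ({c1, y} : Finset (EuclideanSpace ℝ (Fin 3))) ∈ B ↔ (y = p1 ∨ y = n1 ∨ y = m1 ∨ y = q1)) ∧
      (∀ y, ({r1, y} : Finset (EuclideanSpace ℝ (Fin 3))) ∈ B ↔ (y = u1 ∨ y = a1 ∨ y = b1 ∨ y = w1)) ∧
      (({p1, u1} : Finset (EuclideanSpace ℝ (Fin 3))) ∈ B ∧
        ({u1, r1} : Finset (EuclideanSpace ℝ (Fin 3))) ∈ B ∧
        ({r1, b1} : Finset (EuclideanSpace ℝ (Fin 3))) ∈ B ∧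
        ({q1, w1} : Finset (EuclideanSpace ℝ (Fin 3))) ∈ B ∧
        ({w1, r1} : Finset (EuclideanSpace ℝ (Fin 3))) ∈ B ∧
        ({p1, n1} : Finset (EuclideanSpace ℝ (Fin 3))) ∈ B ∧
        ({n1, m1} : Finset (EuclideanSpace ℝ (Fin 3))) ∈ B ∧
        ({m1, q1} : Finset (EuclideanSpace ℝ (Fin 3))) ∈ B) ∧
      (({p1, r1} : Finset (EuclideanSpace ℝ (Fin 3))) ∉ B ∧
        ({u1, b1} : Finset (EuclideanSpace ℝ (Fin 3))) ∉ B ∧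
        ({p1, b1} : Finset (EuclideanSpace ℝ (Fin 3))) ∉ B ∧
        ({q1, r1} : Finset (EuclideanSpace ℝ (Fin 3))) ∉ B ∧
        ({w1, a1} : Finset (EuclideanSpace ℝ (Fin 3))) ∉ B ∧
        ({q1, a1} : Finset (EuclideanSpace ℝ (Fin 3))) ∉ B ∧
        ({p1, m1} : Finset (EuclideanSpace ℝ (Fin 3))) ∉ B ∧
        ({n1, q1} : Finset (EuclideanSpace ℝ (Fin 3))) ∉ B ∧
        ({p1, q1} : Finset (EuclideanSpace ℝ (Fin 3))) ∉ B ∧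
        ({u1, w1} : Finset (EuclideanSpace ℝ (Fin 3))) ∉ B) ∧
      ((p1 ≠ u1 ∧ p1 ≠ r1 ∧ p1 ≠ b1 ∧ u1 ≠ r1 ∧ u1 ≠ b1 ∧ r1 ≠ b1) ∧
        (q1 ≠ w1 ∧ q1 ≠ r1 ∧ q1 ≠ a1 ∧ w1 ≠ r1 ∧ w1 ≠ a1 ∧ r1 ≠ a1) ∧
        (p1 ≠ n1 ∧ p1 ≠ m1 ∧ p1 ≠ q1 ∧ n1 ≠ m1 ∧ n1 ≠ q1 ∧ m1 ≠ q1) ∧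
        (u1 ≠ a1 ∧ u1 ≠ b1 ∧ u1 ≠ w1 ∧ a1 ≠ b1 ∧ a1 ≠ w1 ∧ b1 ≠ w1) ∧ r1 ≠ c1) ∧
      (∀ y, ({p1, y} : Finset (EuclideanSpace ℝ (Fin 3))) ∈ B ↔ (y = a1 ∨ y = u1 ∨ y = c1 ∨ y = n1)) ∧
      (∀ y, ({q1, y} : Finset (EuclideanSpace ℝ (Fin 3))) ∈ B ↔ (y = b1 ∨ y = w1 ∨ y = c1 ∨ y = m1))))
    (h2 : ((p2 ∈ X ∧ q2 ∈ X ∧ u2 ∈ X ∧ w2 ∈ X ∧ m2 ∈ X ∧ n2 ∈ X ∧ r2 ∈ X) ∧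
      (∀ y, ({a2, y} : Finset (EuclideanSpace ℝ (Fin 3))) ∈ B ↔ (y = p2 ∨ y = u2 ∨ y = r2 ∨ y = b2)) ∧
      (∀ y, ({b2, y} : Finset (EuclideanSpace ℝ (Fin 3))) ∈ B ↔ (y = q2 ∨ y = w2 ∨ y = r2 ∨ y = a2)) ∧
      (∀ y, ({c2, y} : Finset (EuclideanSpace ℝ (Fin 3))) ∈ B ↔ (y = p2 ∨ y = n2 ∨ y = m2 ∨ y = q2)) ∧
      (∀ y, ({r2, y} : Finset (EuclideanSpace ℝ (Fin 3))) ∈ B ↔ (y = u2 ∨ y = a2 ∨ y = b2 ∨ y = w2)) ∧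
      (({p2, u2} : Finset (EuclideanSpace ℝ (Fin 3))) ∈ B ∧
        ({u2, r2} : Finset (EuclideanSpace ℝ (Fin 3))) ∈ B ∧
        ({r2, b2} : Finset (EuclideanSpace ℝ (Fin 3))) ∈ B ∧
        ({q2, w2} : Finset (EuclideanSpace ℝ (Fin 3))) ∈ B ∧
        ({w2, r2} : Finset (EuclideanSpace ℝ (Fin 3))) ∈ B ∧
        ({p2, n2} : Finset (EuclideanSpace ℝ (Fin 3))) ∈ B ∧
        ({n2, m2} : Finset (EuclideanSpace ℝ (Fin 3))) ∈ B ∧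
        ({m2, q2} : Finset (EuclideanSpace ℝ (Fin 3))) ∈ B) ∧
      (({p2, r2} : Finset (EuclideanSpace ℝ (Fin 3))) ∉ B ∧
        ({u2, b2} : Finset (EuclideanSpace ℝ (Fin 3))) ∉ B ∧
        ({p2, b2} : Finset (EuclideanSpace ℝ (Fin 3))) ∉ B ∧
        ({q2, r2} : Finset (EuclideanSpace ℝ (Fin 3))) ∉ B ∧
        ({w2, a2} : Finset (EuclideanSpace ℝ (Fin 3))) ∉ B ∧
        ({q2, a2} : Finset (EuclideanSpace ℝ (Fin 3))) ∉ B ∧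
        ({p2, m2} : Finset (EuclideanSpace ℝ (Fin 3))) ∉ B ∧
        ({n2, q2} : Finset (EuclideanSpace ℝ (Fin 3))) ∉ B ∧
        ({p2, q2} : Finset (EuclideanSpace ℝ (Fin 3))) ∉ B ∧
        ({u2, w2} : Finset (EuclideanSpace ℝ (Fin 3))) ∉ B) ∧
      ((p2 ≠ u2 ∧ p2 ≠ r2 ∧ p2 ≠ b2 ∧ u2 ≠ r2 ∧ u2 ≠ b2 ∧ r2 ≠ b2) ∧
        (q2 ≠ w2 ∧ q2 ≠ r2 ∧ q2 ≠ a2 ∧ w2 ≠ r2 ∧ w2 ≠ a2 ∧ r2 ≠ a2) ∧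
        (p2 ≠ n2 ∧ p2 ≠ m2 ∧ p2 ≠ q2 ∧ n2 ≠ m2 ∧ n2 ≠ q2 ∧ m2 ≠ q2) ∧
        (u2 ≠ a2 ∧ u2 ≠ b2 ∧ u2 ≠ w2 ∧ a2 ≠ b2 ∧ a2 ≠ w2 ∧ b2 ≠ w2) ∧ r2 ≠ c2) ∧
      (∀ y, ({p2, y} : Finset (EuclideanSpace ℝ (Fin 3))) ∈ B ↔ (y = a2 ∨ y = u2 ∨ y = c2 ∨ y = n2)) ∧
      (∀ y, ({q2, y} : Finset (EuclideanSpace ℝ (Fin 3))) ∈ B ↔ (y = b2 ∨ y = w2 ∨ y = c2 ∨ y = m2))))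
    {V3 : EuclideanSpace ℝ (Fin 3) → Prop} (hVa1 : V3 a1) (hVa2 : V3 a2) (hVb2 : V3 b2)
    (hVc2 : V3 c2) (hVp1 : ¬ V3 p1) (hVq1 : ¬ V3 q1)
    (hdisj : ∀ y, (y = a1 ∨ y = b1 ∨ y = c1) → ¬ (y = a2 ∨ y = b2 ∨ y = c2))
    (hac1 : a1 ≠ c1) (hbc1 : b1 ≠ c1) (hac2 : a2 ≠ c2) (hbc2 : b2 ≠ c2)
    (hr1 : r1 = c2) (hr2 : r2 = c1) (hu1 : u1 = p2) (hn2 : a1 = n2) (hm2 : b1 = m2) (hw1 : w1 = q2)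
    (hu2 : u2 = q1) (hm1 : a2 = m1) (hn1 : b2 = n1) (hw2 : w2 = p1) : False := by
  classical
  obtain ⟨⟨hp1X, hq1X, hu1X, hw1X, hm1X, hn1X, hr1X⟩, hNa1, hNb1, hNc1, hNr1,
    ⟨hBpu1, hBur1, hBrb1, hBqw1, hBwr1, hBpn1, hBnm1, hBmq1⟩,
    ⟨hBpr1, hBub1, hBpb1, hBqr1, hBwa1, hBqa1, hBpm1, hBnq1, hBpq1, hBuw1⟩,
    ⟨⟨hpu1, hpr1, hpb1, hur1, hub1, hrb1⟩, ⟨hqw1, hqr1, hqa1, hwr1, hwa1, hra1⟩,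
      ⟨hpn1, hpm1, hpq1, hnm1, hnq1, hmq1⟩, ⟨hua1, hub'1, huw1, hab1, haw1, hbw1⟩, hrc1⟩,
    hNp1, hNq1⟩ := h1
  obtain ⟨⟨hp2X, hq2X, hu2X, hw2X, hm2X, hn2X, hr2X⟩, hNa2, hNb2, hNc2, hNr2,
    ⟨hBpu2, hBur2, hBrb2, hBqw2, hBwr2, hBpn2, hBnm2, hBmq2⟩,
    ⟨hBpr2, hBub2, hBpb2, hBqr2, hBwa2, hBqa2, hBpm2, hBnq2, hBpq2, hBuw2⟩,
    ⟨⟨hpu2, hpr2, hpb2, hur2, hub2, hrb2⟩, ⟨hqw2, hqr2, hqa2, hwr2, hwa2, hra2⟩,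
      ⟨hpn2, hpm2, hpq2, hnm2, hnq2, hmq2⟩, ⟨hua2, hub'2, huw2, hab2, haw2, hbw2⟩, hrc2⟩,
    hNp2, hNq2⟩ := h2
  subst r1; subst r2; subst u1; subst w1; subst n2; subst m2; subst u2; subst w2; subst n1; subst m1
  set W : Finset (EuclideanSpace ℝ (Fin 3)) := {a1, b1, c1, p1, q1, a2, b2, c2, p2, q2} with hW
  have hWX : W ⊆ X := by
    intro x hx
    simp only [W, Finset.mem_insert, Finset.mem_singleton] at hx
    rcases hx with rfl | rfl | rfl | rfl | rfl | rfl | rfl | rfl | rfl | rfl <;> assumption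
  have h10 : W.card ≤ 10 := by
    have := List.toFinset_card_le [a1, b1, c1, p1, q1, a2, b2, c2, p2, q2]
    simpa [W] using this
  have hp1a1 : p1 ≠ a1 := (ne_of_mem_bonds hB ((hNa1 p1).2 (Or.inl rfl))).symm
  have hp1c1 : p1 ≠ c1 := (ne_of_mem_bonds hB ((hNc1 p1).2 (Or.inl rfl))).symm
  have hq1b1 : q1 ≠ b1 := (ne_of_mem_bonds hB ((hNb1 q1).2 (Or.inl rfl))).symm
  have hq1c1 : q1 ≠ c1 := (ne_of_mem_bonds hB ((hNc1 q1).2 (Or.inr (Or.inr (Or.inr rfl))))).symm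
  have hq1a1 : q1 ≠ a1 := fun h => hVq1 (h ▸ hVa1)
  have hp1a2 : p1 ≠ a2 := fun h => hVp1 (h ▸ hVa2)
  have hp1b2 : p1 ≠ b2 := fun h => hVp1 (h ▸ hVb2)
  have hp1c2 : p1 ≠ c2 := fun h => hVp1 (h ▸ hVc2)
  have hq1a2 : q1 ≠ a2 := fun h => hVq1 (h ▸ hVa2)
  have hq1b2 : q1 ≠ b2 := fun h => hVq1 (h ▸ hVb2)
  have hq1c2 : q1 ≠ c2 := fun h => hVq1 (h ▸ hVc2)
  have h1a := hdisj a1 (Or.inl rfl)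
  have h1b := hdisj b1 (Or.inr (Or.inl rfl))
  have h1c := hdisj c1 (Or.inr (Or.inr rfl))
  have h8 : 8 ≤ W.card := by
    have hS : ({p1, q1, a1, b1, c1, a2, b2, c2} : Finset (EuclideanSpace ℝ (Fin 3))) ⊆ W := by
      intro x hx
      simp only [Finset.mem_insert, Finset.mem_singleton] at hx
      simp only [W, Finset.mem_insert, Finset.mem_singleton]
      rcases hx with rfl | rfl | rfl | rfl | rfl | rfl | rfl | rfl <;> simp
    have hS8 : ({p1, q1, a1, b1, c1, a2, b2, c2} : Finset (EuclideanSpace ℝ (Fin 3))).card = 8 := by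
      rw [Finset.card_insert_of_notMem, Finset.card_insert_of_notMem, Finset.card_insert_of_notMem,
        Finset.card_insert_of_notMem, Finset.card_insert_of_notMem, Finset.card_insert_of_notMem,
        Finset.card_pair hbc2]
      · simp only [Finset.mem_insert, Finset.mem_singleton, not_or]; exact ⟨hab2, hac2⟩
      · simp only [Finset.mem_insert, Finset.mem_singleton, not_or]
        exact ⟨fun h => h1c (Or.inl h), fun h => h1c (Or.inr (Or.inl h)), fun h => h1c (Or.inr (Or.inr h))⟩
      · simp only [Finset.mem_insert, Finset.mem_singleton, not_or]
        exact ⟨hbc1, fun h => h1b (Or.inl h), fun h => h1b (Or.inr (Or.inl h)),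
          fun h => h1b (Or.inr (Or.inr h))⟩
      · simp only [Finset.mem_insert, Finset.mem_singleton, not_or]
        exact ⟨hab1, hac1, fun h => h1a (Or.inl h), fun h => h1a (Or.inr (Or.inl h)),
          fun h => h1a (Or.inr (Or.inr h))⟩
      · simp only [Finset.mem_insert, Finset.mem_singleton, not_or]
        exact ⟨hq1a1, hq1b1, hq1c1, hq1a2, hq1b2, hq1c2⟩
      · simp only [Finset.mem_insert, Finset.mem_singleton, not_or]
        exact ⟨hpq1, hp1a1, hpb1, hp1c1, hp1a2, hp1b2, hp1c2⟩
    exact hS8 ▸ Finset.card_le_card hS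
  refine false_of_closed hcard hdeg W hWX h8 h10 ?_
  intro x hx z hz
  simp only [W, Finset.mem_insert, Finset.mem_singleton] at hx
  rcases hx with rfl | rfl | rfl | rfl | rfl | rfl | rfl | rfl | rfl | rfl
  · rcases (hNa1 z).1 hz with rfl | rfl | rfl | rfl <;> simp [W]
  · rcases (hNb1 z).1 hz with rfl | rfl | rfl | rfl <;> simp [W]
  · rcases (hNc1 z).1 hz with rfl | rfl | rfl | rfl <;> simp [W]
  · rcases (hNp1 z).1 hz with rfl | rfl | rfl | rfl <;> simp [W]
  · rcases (hNq1 z).1 hz with rfl | rfl | rfl | rfl <;> simp [W]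
  · rcases (hNa2 z).1 hz with rfl | rfl | rfl | rfl <;> simp [W]
  · rcases (hNb2 z).1 hz with rfl | rfl | rfl | rfl <;> simp [W]
  · rcases (hNc2 z).1 hz with rfl | rfl | rfl | rfl <;> simp [W]
  · rcases (hNp2 z).1 hz with rfl | rfl | rfl | rfl <;> simp [W]
  · rcases (hNq2 z).1 hz with rfl | rfl | rfl | rfl <;> simp [W]

end Setting

end Summit.AtomisticToContinuum.Crystallization.Theorems
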